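import Mathlib
import Summits.Ventures.PercRepro0.HighDClose
import Summits.Ventures.PercRepro0.PcChi
import Summits.Ventures.PercRepro0.ContinuityCoupling

/-!
# R_MID-2 · TWO-POINT and the R_MID-3 chain on the cell's definitions (seat p3)

Kernel-checked twin of proofs/RMID-p6-v1.md §3–§4 (block M reductions; REDUCTIONS of the residual,
not progress on its truth): for `d ≥ 1`, at the route's `p_c(d)` and given P3 · UNIQUE in dimension `d`,

`T d ⟺ τ_{p_c}(0,x) → 0 as ‖x‖_∞ → ∞ ⟺ inf_x τ_{p_c}(0,x) = 0`,

and the chain `∇_{p_c} < ∞ ⇒ Σ_x τ_{p_c}(0,x)² < ∞ ⇒ τ_{p_c}(0,x) → 0 ⇒ T d`.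

* `tau_le_P_toBoundary` — Lemma 2.1: `τ_p(0,x) ≤ P_p(0 ↔ ∂Λ_n)` for `n ≤ ‖x‖_∞`
  (`PcChi.conn_subset_toBoundary` + `toBoundary_antitone`);
* `tendsto_tau_cofinite_of_thetaI_eq_zero` — (a) ⇒ (b) at any `p`: `θ_d(p) = 0 ⇒ τ_p(0,·) → 0`
  along the cofinite filter (L2's `tendsto_P_toBoundary`);
* `thetaI_eq_zero_of_forall_exists_lt` — (c) ⇒ (a) at any `p` given P3 (H4 through
  `HighDClose.thetaI_sq_le_tau_of_P3`);
* `T_iff_tendsto_tau`, `T_iff_forall_exists_lt`, `T_iff_iInf_tau_eq_zero` — R_MID-2 at `p_c(d)`;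
* `bubble_of_triangle`, `tendsto_tau_of_bubble`, `T_of_bubble` — the R_MID-3 chain
  (`HighDGlue.summable_sq_of_summable_triangle`, `Summable.tendsto_cofinite_zero`).

Only the direction «decay ⇒ T» uses P3 (and P7, F1, F2, all kernel-checked); everything else is
definitions + L2. Nothing here decides `T d` for any `3 ≤ d ≤ 10`.
-/

namespace Summit.Ventures.PercRepro0.TwoPoint

open MeasureTheory ProbabilityTheory unitInterval Defs Filter Topology

variable {d : ℕ}

/-- Lemma 2.1: `τ_p(0,x) ≤ P_p(0 ↔ ∂Λ_n)` whenever `n ≤ ‖x‖_∞` (`d ≥ 1`). -/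
theorem tau_le_P_toBoundary (hd : 1 ≤ d) (p : I) {n : ℕ} {x : Vertex d} (hn : n ≤ PcChi.nrm x) :
    tau d p 0 x ≤ (P d p (toBoundary d n)).toReal := by
  unfold tau
  refine ENNReal.toReal_mono (measure_ne_top _ _) (measure_mono ?_)
  exact (PcChi.conn_subset_toBoundary hd x).trans (toBoundary_antitone (d := d) hn)

/-- `0 ≤ τ_p(x,y)`. -/
theorem tau_nonneg (p : I) (x y : Vertex d) : 0 ≤ tau d p x y := ENNReal.toReal_nonneg

/-- (a) ⇒ (b) at any `p`: if `θ_d(p) = 0` then `τ_p(0,x) → 0` as `‖x‖_∞ → ∞` (along the cofinite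
filter on `ℤ^d`), by Lemma 2.1 and L2 (`P_p(0 ↔ ∂Λ_n) → θ_d(p)`). -/
theorem tendsto_tau_cofinite_of_thetaI_eq_zero (hd : 1 ≤ d) (p : I) (h : thetaI d p = 0) :
    Tendsto (fun x : Vertex d => tau d p 0 x) cofinite (𝓝 0) := by
  rw [Metric.tendsto_nhds]
  intro ε hε
  have hlim := tendsto_P_toBoundary (d := d) p
  rw [h] at hlim
  obtain ⟨N, hN⟩ := (hlim.eventually (gt_mem_nhds hε)).exists
  rw [Filter.eventually_cofinite]
  refine ((PcChi.boxF d N).finite_toSet).subset fun x hx => ?_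
  by_contra hxN
  have hlt : N ≤ PcChi.nrm x := by
    have : ¬ PcChi.nrm x ≤ N := fun h' => hxN (PcChi.mem_boxF.2 h')
    omega
  apply hx
  rw [Real.dist_eq, sub_zero, abs_of_nonneg (tau_nonneg p 0 x)]
  exact lt_of_le_of_lt (tau_le_P_toBoundary hd p hlt) hN

/-- (b) ⇒ (c) at any `p` (`d ≥ 1`): decay along the cofinite filter gives arbitrarily small values. -/
theorem forall_exists_lt_of_tendsto (hd : 1 ≤ d) (p : I)
    (h : Tendsto (fun x : Vertex d => tau d p 0 x) cofinite (𝓝 0)) :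
    ∀ ε : ℝ, 0 < ε → ∃ x : Vertex d, tau d p 0 x < ε := by
  intro ε hε
  haveI : Infinite (Vertex d) := HighD.infinite_vertex d hd
  exact (h.eventually (gt_mem_nhds hε)).exists

/-- (c) ⇒ (a) at any `p`, given P3 in dimension `d`: `θ_d(p)² ≤ τ_p(0,x)` for every `x` (H4), so
arbitrarily small values of `τ_p(0,·)` force `θ_d(p) = 0`. -/
theorem thetaI_eq_zero_of_forall_exists_lt (p : I) (hP3 : P3_Unique d)
    (h : ∀ ε : ℝ, 0 < ε → ∃ x : Vertex d, tau d p 0 x < ε) : thetaI d p = 0 := by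
  by_contra hne
  have hpos : 0 < thetaI d p ^ 2 :=
    pow_pos (lt_of_le_of_ne (thetaI_nonneg d p) (Ne.symm hne)) 2
  obtain ⟨x, hx⟩ := h _ hpos
  exact absurd (HighD.thetaI_sq_le_tau_of_P3 d p x hP3) (not_le.2 hx)

/-- For a non-negative real family on a non-empty type, `⨅ x, f x = 0` iff the family takes
arbitrarily small values. -/
theorem iInf_eq_zero_iff {ι : Type*} [Nonempty ι] (f : ι → ℝ) (hf : ∀ x, 0 ≤ f x) :
    (⨅ x, f x) = 0 ↔ ∀ ε : ℝ, 0 < ε → ∃ x, f x < ε := by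
  have hbdd : BddBelow (Set.range f) := ⟨0, by rintro _ ⟨x, rfl⟩; exact hf x⟩
  constructor
  · intro h ε hε
    exact exists_lt_of_ciInf_lt (by rw [h]; exact hε)
  · intro h
    refine le_antisymm ?_ (le_ciInf hf)
    refine le_of_forall_pos_lt_add fun ε hε => ?_
    obtain ⟨x, hx⟩ := h ε hε
    calc (⨅ x, f x) ≤ f x := ciInf_le hbdd x
      _ < 0 + ε := by linarith

/-- R_MID-2 (a) ⟺ (b) at `p_c(d)`, `d ≥ 1`, given P3: `T d` iff `τ_{p_c}(0,x) → 0` as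
`‖x‖_∞ → ∞`. -/
theorem T_iff_tendsto_tau (hd : 1 ≤ d) (hP3 : P3_Unique d) :
    T d ↔ Tendsto (fun x : Vertex d => tau d (clamp (pc d)) 0 x) cofinite (𝓝 0) := by
  constructor
  · intro hT
    exact tendsto_tau_cofinite_of_thetaI_eq_zero hd _ hT
  · intro h
    exact thetaI_eq_zero_of_forall_exists_lt _ hP3 (forall_exists_lt_of_tendsto hd _ h)

/-- R_MID-2 (a) ⟺ (c) at `p_c(d)`, `d ≥ 1`, given P3: `T d` iff `τ_{p_c}(0,·)` takes arbitrarily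
small values. -/
theorem T_iff_forall_exists_lt (hd : 1 ≤ d) (hP3 : P3_Unique d) :
    T d ↔ ∀ ε : ℝ, 0 < ε → ∃ x : Vertex d, tau d (clamp (pc d)) 0 x < ε := by
  constructor
  · intro hT
    exact forall_exists_lt_of_tendsto hd _ (tendsto_tau_cofinite_of_thetaI_eq_zero hd _ hT)
  · intro h
    exact thetaI_eq_zero_of_forall_exists_lt _ hP3 h

/-- R_MID-2 (a) ⟺ (c), infimum form: `T d ↔ inf_x τ_{p_c}(0,x) = 0` (`d ≥ 1`, given P3). -/
theorem T_iff_iInf_tau_eq_zero (hd : 1 ≤ d) (hP3 : P3_Unique d) :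
    T d ↔ (⨅ x : Vertex d, tau d (clamp (pc d)) 0 x) = 0 := by
  haveI : Nonempty (Vertex d) := ⟨0⟩
  rw [T_iff_forall_exists_lt hd hP3, iInf_eq_zero_iff _ (fun x => tau_nonneg _ 0 x)]

/-! ## The R_MID-3 chain: triangle ⇒ bubble ⇒ decay ⇒ `T` -/

/-- H2(i): the triangle condition at `p` gives the bubble condition at `p`. -/
theorem bubble_of_triangle (p : I) (hT : TriangleCondition d p) : BubbleCondition d p := by
  have h := HighD.summable_sq_of_summable_triangle (tau d p) 0 (HighD.tau_self d p 0)
    (fun x => HighD.tau_symm d p x 0) hT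
  unfold BubbleCondition
  refine h.congr fun x => ?_
  ring

/-- H2(ii): the bubble condition at `p` forces `τ_p(0,x) → 0` as `‖x‖_∞ → ∞`. -/
theorem tendsto_tau_of_bubble (p : I) (hB : BubbleCondition d p) :
    Tendsto (fun x : Vertex d => tau d p 0 x) cofinite (𝓝 0) := by
  have h1 : Tendsto (fun x : Vertex d => tau d p 0 x * tau d p 0 x) cofinite (𝓝 0) :=
    hB.tendsto_cofinite_zero
  have h2 : Tendsto (fun x : Vertex d => Real.sqrt (tau d p 0 x * tau d p 0 x)) cofinite
      (𝓝 (Real.sqrt 0)) :=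
    (Real.continuous_sqrt.tendsto 0).comp h1
  rw [Real.sqrt_zero] at h2
  refine h2.congr fun x => ?_
  exact Real.sqrt_mul_self (tau_nonneg p 0 x)

/-- R_MID-3 (weak form): the bubble condition at `p_c(d)` and P3 give `T d` (`d ≥ 1`). -/
theorem T_of_bubble (hd : 1 ≤ d) (hP3 : P3_Unique d) (hB : BubbleCondition d (clamp (pc d))) :
    T d :=
  (T_iff_tendsto_tau hd hP3).2 (tendsto_tau_of_bubble _ hB)

/-- R_MID-3 (triangle form, through the chain): the triangle condition at `p_c(d)` and P3 give
`T d` (`d ≥ 1`); the same conclusion as `HighDClose.T_of_triangle_of_P3`, here via the bubble. -/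
theorem T_of_triangle' (hd : 1 ≤ d) (hP3 : P3_Unique d) (hT : TriangleCondition d (clamp (pc d))) :
    T d :=
  T_of_bubble hd hP3 (bubble_of_triangle _ hT)

end Summit.Ventures.PercRepro0.TwoPoint
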